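import Literature.AlgebraicGeometry.AbelianSchemes.AbelianSchemeDualTransport
import Literature.AlgebraicGeometry.AbelianSchemes.AbelianSchemeOverFibreIdentity
import HarnessLib

/-!
# The fibre isomorphism `fibreIsoOfIso e (𝟙 S)` at the identity point IS the given isomorphism of identity fibres
# (junction of ★ `AbelianSchemeDualTransport` §0 with ★ `AbelianSchemeOverFibreIdentity` §3)

Topic `AlgebraicGeometry/AbelianSchemes`; namespace `Literature.AlgebraicGeometry.AbelianSchemes.AbelianSchemeOver`.
Cell hodgecm-mathlib (D-0151), rung-0 ladder / M1PRIME-DAG **W3c** (B-p11's `TripleTransportAlongId`: the group-scheme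
isomorphism `grpIsoOfFibreIso Pσ.A P″.A h` of ★ `AbelianSchemeOverFibreIdentity` is fed to ★ `AbelianSchemeDualTransport`
as `e`; this file says that `fibreIsoOfIso e (𝟙 _)` — through which `valueAt_lamTransport` / `sliceAt_lamTransport_comp_map`
(★ `AbelianSchemeDualTransportSlice`) read the points — is `h` again, so the marked data (`hjσ`, the towers) apply
verbatim).  THEOREMS ONLY; no structure, no named fact, no instance, no `sorry`; books 0.
HC_CM is proved only modulo the printed citations until rung 0 closes.

## What is proved
* `fibreIsoOfIso_id_eq_of_fst_comp` — for `e : A'.X ≅ A.X` (group schemes over `Spec K`) and an isomorphism `h` of the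
  identity fibres with `(A' ×_K K → A') ≫ e = h ≫ (A ×_K K → A)`, `fibreIsoOfIso e (𝟙 _) = h` (morphisms of abelian
  varieties are determined by their underlying scheme maps; both lie over `Spec K`);
* `fst_comp_grpIsoOfFibreIso_hom_left` — the bridge isomorphism of ★ `AbelianSchemeOverFibreIdentity` satisfies that
  hypothesis: `(A' ×_K K → A') ≫ (grpIsoOfFibreIso A' A h) = h ≫ (A ×_K K → A)`.

## References
* [GortzWedhorn2020] U. Görtz, T. Wedhorn, *Algebraic Geometry I*, 2nd ed. (2020), Section (4.7) (p. 135) (`X ×_S S = X`).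
* [MumfordFogartyKirwan1994] D. Mumford, J. Fogarty, F. Kirwan, *Geometric Invariant Theory*, 3rd ed. (1994), Ch. 7 §2
  Definition 7.3 (p. 130).
-/

set_option autoImplicit false

universe u

open CategoryTheory CategoryTheory.Limits AlgebraicGeometry MonoidalCategory

noncomputable section

namespace Literature.AlgebraicGeometry.AbelianSchemes

namespace AbelianSchemeOver

open Literature.AlgebraicGeometry.Motives
open scoped MonObj

section AnyUniverse

variable {K : Type u} [Field K] {A A' : AbelianSchemeOver (Spec (.of K))} (e : A'.X ≅ A.X) [IsMonHom e.hom]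

/-- **`fibreIsoOfIso e (𝟙) = h`** when `e` restricts to `h` on the identity fibres (`(A' ×_K K → A') ≫ e = h ≫ (A ×_K K → A)`):
a morphism of abelian varieties is determined by its underlying morphism of `K`-schemes, and both sides lie over `Spec K`.
[cite: GortzWedhorn2020, Section (4.7) (p. 135)] -/
theorem fibreIsoOfIso_id_eq_of_fst_comp
    (h : (A'.fibre (𝟙 (Spec (.of K)))).toAbelianVariety ≅ (A.fibre (𝟙 (Spec (.of K)))).toAbelianVariety)
    (he : pullback.fst A'.X.hom (𝟙 (Spec (.of K))) ≫ e.hom.left =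
      AbelianVariety.Hom.toSchemeHom h.hom ≫ pullback.fst A.X.hom (𝟙 (Spec (.of K)))) :
    fibreIsoOfIso e (𝟙 (Spec (.of K))) = h := by
  have hw : AbelianVariety.Hom.toSchemeHom h.hom ≫ pullback.snd A.X.hom (𝟙 (Spec (.of K))) =
      pullback.snd A'.X.hom (𝟙 (Spec (.of K))) := by
    have hw' := Over.w h.hom.hom.hom.hom
    exact hw'
  have hl : AbelianVariety.Hom.toSchemeHom (fibreIsoOfIso e (𝟙 (Spec (.of K)))).hom =
      AbelianVariety.Hom.toSchemeHom h.hom := by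
    apply pullback.hom_ext
    · exact (fibreIsoOfIso_hom_toSchemeHom_fst e (𝟙 _)).trans he
    · exact (fibreIsoOfIso_hom_toSchemeHom_snd e (𝟙 _)).trans hw.symm
  exact Iso.ext (AbelianVariety.hom_ext _ _ (Over.OverMorphism.ext hl))

end AnyUniverse

section UniverseZero

variable {K : Type} [Field K]

/-- **The bridge isomorphism restricts to `h` on the identity fibres**: `(A' ×_K K → A') ≫ grpIsoOfFibreIso A' A h =
h ≫ (A ×_K K → A)` (★ `grpIsoOfFibreIso_hom_left`: the bridge is `inv ≫ h ≫ fst` with `fst ≫ inv = 𝟙`).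
[cite: GortzWedhorn2020, Section (4.7) (p. 135)] -/
theorem fst_comp_grpIsoOfFibreIso_hom_left (A' A : AbelianSchemeOver (Spec (.of K)))
    (h : (A'.fibre (𝟙 (Spec (.of K)))).toAbelianVariety ≅ (A.fibre (𝟙 (Spec (.of K)))).toAbelianVariety) :
    pullback.fst A'.X.hom (𝟙 (Spec (.of K))) ≫ (grpIsoOfFibreIso A' A h).hom.hom.hom.left =
      AbelianVariety.Hom.toSchemeHom h.hom ≫ pullback.fst A.X.hom (𝟙 (Spec (.of K))) := by
  have h1 : pullback.fst A'.X.hom (𝟙 (Spec (.of K))) ≫ (fibreIdToGrpIso A').inv.hom.hom.left = 𝟙 _ := by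
    rw [← fibreIdToGrpIso_hom_left]
    change ((fibreIdToGrpIso A').hom ≫ (fibreIdToGrpIso A').inv).hom.hom.left = _
    rw [Iso.hom_inv_id]
    rfl
  have h2 := reassoc_of% h1
  rw [grpIsoOfFibreIso_hom_left]
  exact h2 _

/-- **Junction**: for `e` the group-scheme isomorphism underlying `grpIsoOfFibreIso A' A h` (any `e : A'.X ≅ A.X` with the same
underlying scheme map), `fibreIsoOfIso e (𝟙) = h`. [cite: MumfordFogartyKirwan1994, Ch. 7 §2 Definition 7.3 (p. 130)] -/
theorem fibreIsoOfIso_id_eq_of_left_eq_grpIsoOfFibreIso {A A' : AbelianSchemeOver (Spec (.of K))} (e : A'.X ≅ A.X) [IsMonHom e.hom]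
    (h : (A'.fibre (𝟙 (Spec (.of K)))).toAbelianVariety ≅ (A.fibre (𝟙 (Spec (.of K)))).toAbelianVariety)
    (he : e.hom.left = (grpIsoOfFibreIso A' A h).hom.hom.hom.left) :
    fibreIsoOfIso e (𝟙 (Spec (.of K))) = h :=
  fibreIsoOfIso_id_eq_of_fst_comp e h (by rw [he]; exact fst_comp_grpIsoOfFibreIso_hom_left A' A h)

end UniverseZero

end AbelianSchemeOver

end Literature.AlgebraicGeometry.AbelianSchemes

end
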